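import Summits.AtomisticToContinuum.Crystallization.Theorems.FrustratedLawDichotomyCellKitX

/-!
# FrustratedLawDichotomy · crux `AperiodicFrustratedLawGap` (stmt-AtomisticToContinuum-27623) — CELL KIT X in KERNEL-SIZED PARTS
# (decomp-a2c, prover hand 2, generation 17)

`…CellKitX.checkMove` evaluates fourteen supercell sums (≈ 14 000 points each for a 2-atom cell at `k₀ = 9`) plus the bin and cover scans; as ONE
`decide +kernel` this exceeds the farm's per-declaration budget (measured: the four component scans pass in ≈ 200 s total, the monolith does not
return).  This file splits the check: `checkArith` is the cheap arithmetic tail of `checkMove` on GIVEN values of the sums, and ★ `checkMove_of_parts`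
reassembles `checkMove = true` from `checkBins = true`, `checkCover = true`, fourteen kernel-checked sum EQUALITIES `sumX … = literal` and
`checkArith … = true` on the literals.  All `[folklore]`; 0 sorry.
-/

namespace Summit.AtomisticToContinuum.Crystallization.Theorems.FrustratedLawDichotomyCellKitX

open Summit.AtomisticToContinuum.Crystallization.Theorems.FrustratedLawDichotomyCellChecker (Cell)

/-- The arithmetic tail of `checkMove` on given values `S, F_a, C_ab, B_a, C₄` of the fourteen sums and the rounding slack `τ`:
`β`/`φ_F` enclosures, the three `LDLᵀ` pivots of `(S − λ)I + C`, and the closed scalar condition. -/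
def checkArith (P : XParams) (X : XCert) (τ S f0 f1 f2 C00 C01 C02 C11 C12 C22 B0 B1 B2 C4 : ℚ) : Bool :=
  let d0 := S + C00 - X.lam
  let l10 := C01 / d0
  let l20 := C02 / d0
  let d1 := S + C11 - X.lam - l10 ^ 2 * d0
  let l21 := (C12 - l20 * l10 * d0) / d1
  let d2 := S + C22 - X.lam - l20 ^ 2 * d0 - l21 ^ 2 * d1
  let C4m := min C4 0
  let L := X.lam - X.beta * P.s + C4m * P.s ^ 2
  decide (0 ≤ X.beta) && decide (B0 ^ 2 + B1 ^ 2 + B2 ^ 2 ≤ X.beta ^ 2) &&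
  decide (0 ≤ X.phiF) && decide ((|f0| + τ) ^ 2 + (|f1| + τ) ^ 2 + (|f2| + τ) ^ 2 ≤ X.phiF ^ 2) &&
  decide (0 < d0) && decide (0 < d1) && decide (0 ≤ d2) &&
  decide (0 < L) && decide (X.phiF ^ 2 ≤ 4 * L * slackQ P.ε P.s P.Rm)

variable (c : Cell)

/-- `checkMove` is `checkBins ∧ checkCover ∧ checkArith` at the fourteen sums (definitional bookkeeping). [folklore] -/
theorem checkMove_eq_parts (P : XParams) (X : XCert) (m : Fin c.N₀) :
    checkMove c P X m = (checkBins c P X && checkCover c P X m &&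
      checkArith P X (tauOf c) (sumX c (termS c P m)) (sumX c (termF c P 0 m)) (sumX c (termF c P 1 m)) (sumX c (termF c P 2 m))
        (sumX c (termC c P X.bins 0 0 m)) (sumX c (termC c P X.bins 0 1 m)) (sumX c (termC c P X.bins 0 2 m))
        (sumX c (termC c P X.bins 1 1 m)) (sumX c (termC c P X.bins 1 2 m)) (sumX c (termC c P X.bins 2 2 m))
        (sumX c (termB c P X.bins 0 m)) (sumX c (termB c P X.bins 1 m)) (sumX c (termB c P X.bins 2 m)) (sumX c (termC4 c P X.bins m))) := by
  simp only [checkMove, checkArith, Bool.and_assoc]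

/-- ★ **`checkMove = true` from kernel-sized parts**: the bin and cover scans, fourteen sum equalities, and the arithmetic tail on the literals.
[folklore] -/
theorem checkMove_of_parts {P : XParams} {X : XCert} {m : Fin c.N₀} {S f0 f1 f2 C00 C01 C02 C11 C12 C22 B0 B1 B2 C4 : ℚ}
    (hbins : checkBins c P X = true) (hcov : checkCover c P X m = true)
    (hS : sumX c (termS c P m) = S) (hf0 : sumX c (termF c P 0 m) = f0) (hf1 : sumX c (termF c P 1 m) = f1) (hf2 : sumX c (termF c P 2 m) = f2)
    (h00 : sumX c (termC c P X.bins 0 0 m) = C00) (h01 : sumX c (termC c P X.bins 0 1 m) = C01) (h02 : sumX c (termC c P X.bins 0 2 m) = C02)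
    (h11 : sumX c (termC c P X.bins 1 1 m) = C11) (h12 : sumX c (termC c P X.bins 1 2 m) = C12) (h22 : sumX c (termC c P X.bins 2 2 m) = C22)
    (hB0 : sumX c (termB c P X.bins 0 m) = B0) (hB1 : sumX c (termB c P X.bins 1 m) = B1) (hB2 : sumX c (termB c P X.bins 2 m) = B2)
    (hC4 : sumX c (termC4 c P X.bins m) = C4)
    (harith : checkArith P X (tauOf c) S f0 f1 f2 C00 C01 C02 C11 C12 C22 B0 B1 B2 C4 = true) :
    checkMove c P X m = true := by
  rw [checkMove_eq_parts, hbins, hcov, hS, hf0, hf1, hf2, h00, h01, h02, h11, h12, h22, hB0, hB1, hB2, hC4, harith]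
  rfl

end Summit.AtomisticToContinuum.Crystallization.Theorems.FrustratedLawDichotomyCellKitX
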